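import Literature.Geometry.Kaehler.LelongNumberExists
import Literature.Geometry.Kaehler.HolomorphicChainPlane
import Literature.Geometry.Kaehler.HolomorphicChainLelongProofs
import HarnessLib

/-!
# The Monge–Ampère mass of a radial profile weight on a complex `p`-space: `∫_{B(b,ρ)} (dd^c w_h)ᵖ = p! 2ᵖ c(2p)`

Let `P` be a complex inner product space of dimension `p = q + 1`, `b ∈ P`, `ρ > 0`, and `w_h` the
radial profile weight of a profile transition `h` located left of `log ρ - 1`, centred at `b`
(`ChainRadialStokes.lean`). Then for every unitary `p`-frame `e` of `P`,

`∫_{B(b, ρ)} (dd^c w_h)(z)ᵖ(e₀, i e₀, …) d𝓗^{2p}(z) = p! 2ᵖ c(2p)`, `c(2p) = unitBallVolume (2p)`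

(`integral_ball_twoPow_ddcForm_radialWeight`) — the value `k = 1` of the "cover evaluation" in
the comparison proof of `n(A, a) = μ_a(A)`, here read off from `LelongNumberExists.lean` applied to
the plane chain `[P] = [planeSet ⊤]` (`HolomorphicChainPlane.lean`): its carrier is all of `P`,
its orientation at every point is the real frame of a unitary BASIS of `P`, so the tangential
fraction is `1` and the defect `W` vanishes (`lelongW_plane_eq_zero`), while the limit `Λ` of the
mass ratios of `P` at `b` is `c(2p)` (`Chirka1989_lelongNumber_eq_one_of_mem_regularLocus`, every
point of a plane being regular). Equivalently: `∫_{B(0,ρ)} (dd^c g(log|w|))ᵖ = p! 2ᵖ c(2p)` for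
every convex increasing `g` with `g' = h` a transition left of `log ρ - 1` — by polar coordinates
this is `p! 2ᵖ · 2p c(2p) ∫ ½ h^{p-1} h' = p! 2ᵖ c(2p)` [Chirka1989, §15.1 (the cone case,
`(vol A₁)/c(p) = n(A, 0)`)].

## References

* E. M. Chirka, *Complex Analytic Sets*, Kluwer 1989, §15.1 [Chirka1989].
* J.-P. Demailly, *Complex analytic and differential geometry*, Ch. III (5.6), Thm. 7.7.
-/

noncomputable section

open scoped Manifold Topology ENNReal InnerProductSpace ContDiff
open Set Filter MeasureTheory Metric Module

universe u

namespace Literature.Geometry.Kaehler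

open Literature.Geometry.GeometricMeasureTheory TwoForm

variable {P : Type u} [NormedAddCommGroup P] [InnerProductSpace ℂ P] [FiniteDimensional ℂ P]
  [MeasurableSpace P] [BorelSpace P] {q : ℕ}

namespace HolomorphicChain

omit [FiniteDimensional ℂ P] [MeasurableSpace P] [BorelSpace P] in
/-- `dim (⊤ : Submodule ℂ P) = q + 1` when `dim P = q + 1`. [folklore] -/
theorem finrank_top_eq (hP : finrank ℂ P = q + 1) : finrank ℂ (⊤ : Submodule ℂ P) = q + 1 := by
  rw [finrank_top, hP]

omit [MeasurableSpace P] [BorelSpace P] in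
/-- The carrier of the plane chain `[P]` is everything. [folklore] -/
theorem carrier_plane_top (hP : finrank ℂ P = q + 1) :
    (plane (⊤ : Submodule ℂ P) (finrank_top_eq hP)).carrier = univ := by
  rw [carrier_plane]; rfl

omit [FiniteDimensional ℂ P] [MeasurableSpace P] [BorelSpace P] in
/-- `↑ '' planeSet ⊤ = univ`. [folklore] -/
theorem image_coe_planeSet_top :
    ((↑) : (⊤ : TopologicalSpace.Opens P) → P) '' planeSet (⊤ : Submodule ℂ P) = univ := by
  rw [image_coe_planeSet]; rfl

omit [MeasurableSpace P] [BorelSpace P] in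
/-- **A unitary `p`-frame of a `p`-dimensional space is Parseval**: `Σ |⟨z, eᵢ⟩|² = ‖z‖²`. [folklore] -/
theorem sum_norm_sq_inner_eq_of_finrank (hP : finrank ℂ P = q + 1) {u : Fin (q + 1) → P}
    (hu : Orthonormal ℂ u) (z : P) : ∑ i, ‖⟪z, u i⟫_ℂ‖ ^ 2 = ‖z‖ ^ 2 := by
  have hsp : ⊤ ≤ Submodule.span ℂ (range u) := by
    have hli := hu.linearIndependent
    have hcard : Fintype.card (Fin (q + 1)) = finrank ℂ P := by rw [Fintype.card_fin, hP]
    rw [hli.span_eq_top_of_card_eq_finrank' hcard]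
  set b := OrthonormalBasis.mk hu hsp with hb
  have hb' : ∀ i, b i = u i := fun i => by rw [hb, OrthonormalBasis.coe_mk]
  have := b.sum_sq_norm_inner_right z
  simp_rw [hb', norm_inner_symm] at this
  simpa using this

/-- **Frame independence on the plane chain**: the value of a `2p`-covector on the orientation of
`[P]` at any point equals its value on the real frame of ANY unitary `p`-frame of `P`. [folklore] -/
theorem apply_orientationFrame_plane_top_eq (hP : finrank ℂ P = q + 1) (φ : P [⋀^Fin (2 * (q + 1))]→L[ℝ] ℝ)
    {e : Fin (q + 1) → P} (he : Orthonormal ℂ e) (z : P) :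
    φ ((plane (⊤ : Submodule ℂ P) (finrank_top_eq hP)).orientationFrame z) = φ (complexFrame e) := by
  have hz : z ∈ (plane (⊤ : Submodule ℂ P) (finrank_top_eq hP)).carrier := by
    rw [carrier_plane_top hP]; trivial
  obtain ⟨u, hu, hξ⟩ := (plane (⊤ : Submodule ℂ P) (finrank_top_eq hP)).exists_orientationFrame_eq_complexFrame hz
  rw [hξ]
  have hsp : Submodule.span ℂ (range u) = ⊤ := by
    have hcard : Fintype.card (Fin (q + 1)) = finrank ℂ P := by rw [Fintype.card_fin, hP]
    exact hu.linearIndependent.span_eq_top_of_card_eq_finrank' hcard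
  refine (apply_complexFrame_eq_of_orthonormal φ hu he fun j => ?_).symm
  rw [hsp]; trivial

/-- On the plane chain the tangential square is the full square: `τ_{[P]}(b, z) = ‖z - b‖²`. [folklore] -/
theorem tangentialSq_plane_top (hP : finrank ℂ P = q + 1) (b z : P) :
    (plane (⊤ : Submodule ℂ P) (finrank_top_eq hP)).tangentialSq b z = ‖z - b‖ ^ 2 := by
  have hz : z ∈ (plane (⊤ : Submodule ℂ P) (finrank_top_eq hP)).carrier := by
    rw [carrier_plane_top hP]; trivial
  obtain ⟨u, hu, hξ⟩ := (plane (⊤ : Submodule ℂ P) (finrank_top_eq hP)).exists_orientationFrame_eq_complexFrame hz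
  rw [(plane (⊤ : Submodule ℂ P) (finrank_top_eq hP)).tangentialSq_eq_of_eq_complexFrame hξ,
    sum_norm_sq_inner_eq_of_finrank hP hu]

/-- **The defect of a plane vanishes**: `W_{[P]}(b, ρ) = 0` (the tangential fraction is `1` a.e.).
[cite: Chirka1989, §15.1] -/
theorem lelongW_plane_top_eq_zero (hP : finrank ℂ P = q + 1) (b : P) (ρ : ℝ) :
    (plane (⊤ : Submodule ℂ P) (finrank_top_eq hP)).lelongW b ρ = 0 := by
  set T := plane (⊤ : Submodule ℂ P) (finrank_top_eq hP) with hT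
  have hae : ∀ᵐ z ∂((μHE[2 * (q + 1)] : Measure P).restrict (T.carrier ∩ ball b ρ)),
      ENNReal.ofReal ((radA b z ^ (2 * (q + 1)))⁻¹ * (1 - T.tangentialFraction b z)) = 0 := by
    have hle : (μHE[2 * (q + 1)] : Measure P).restrict (T.carrier ∩ ball b ρ) ≤
        (μHE[2 * (q + 1)] : Measure P).restrict T.carrier :=
      Measure.restrict_mono inter_subset_left le_rfl
    filter_upwards [ae_mono hle (T.ae_tangentialFraction_eq b), ae_mono hle (T.ae_ne_centre b)] with z hz hzb
    rw [hz, hT, tangentialSq_plane_top hP, div_self (pow_ne_zero _ (norm_ne_zero_iff.2 (sub_ne_zero.2 hzb))),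
      sub_self, mul_zero, ENNReal.ofReal_zero]
  rw [lelongW, lintegral_congr_ae hae, lintegral_zero]

/-- **The mass ratios of a plane tend to `c(2p)`**: `𝓗^{2p}(P ∩ B(b,r))/r^{2p} → unitBallVolume (2p)`.
[cite: Chirka1989, §15.1 Prop. 2 (regular points)] -/
theorem tendsto_measure_ball_div_pow_plane (hP : finrank ℂ P = q + 1) (b : P) :
    Tendsto (fun r : ℝ => (μHE[2 * (q + 1)] : Measure P)
        (((↑) : (⊤ : TopologicalSpace.Opens P) → P) '' planeSet (⊤ : Submodule ℂ P) ∩ ball b r) /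
          ENNReal.ofReal (r ^ (2 * (q + 1)))) (𝓝[>] 0) (𝓝 (unitBallVolume (2 * (q + 1)))) := by
  have hreg : (⟨b, trivial⟩ : (⊤ : TopologicalSpace.Opens P)) ∈
      regularLocus 𝓘(ℂ, P) (planeSet (⊤ : Submodule ℂ P)) := by
    rw [regularLocus_planeSet]; show b ∈ (⊤ : Submodule ℂ P); trivial
  have h1 := Chirka1989_lelongNumber_eq_one_of_mem_regularLocus P ⊤ (q + 1) (planeSet ⊤)
    (hasPureDim_planeSet ⊤ (finrank_top_eq hP)) ⟨b, trivial⟩ hreg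
  have hc := unitBallVolume_ne_zero_ne_top (2 * (q + 1))
  have h2 := ENNReal.Tendsto.const_mul (a := unitBallVolume (2 * (q + 1))) h1 (Or.inl one_ne_zero)
  rw [mul_one] at h2
  refine h2.congr' ?_
  filter_upwards [self_mem_nhdsWithin] with r (hr : 0 < r)
  have hr0 : ENNReal.ofReal (r ^ (2 * (q + 1))) ≠ 0 := by
    rw [ne_eq, ENNReal.ofReal_eq_zero, not_le]; positivity
  show unitBallVolume (2 * (q + 1)) * (_ / (unitBallVolume (2 * (q + 1)) * ENNReal.ofReal (r ^ (2 * (q + 1))))) = _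
  rw [ENNReal.div_eq_inv_mul, ENNReal.div_eq_inv_mul, ENNReal.mul_inv (Or.inl hc.1) (Or.inl hc.2), ← mul_assoc,
    ← mul_assoc, ENNReal.mul_inv_cancel hc.1 hc.2, one_mul]

/-- **The Monge–Ampère mass of a radial profile weight on a ball of a complex `p`-space**, in the
normalisation of `exists_lelong_data`: for `ρ > 0` and a profile `h` located left of `log ρ - 1`,
`((q+1)! 2^{q+1})⁻¹ ∫_{B(b,ρ)} (dd^c w_h)^{q+1}(ξ_{[P]}) d𝓗 = c(2(q+1))` in `ℝ≥0∞`.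
[cite: Chirka1989, §15.1] -/
theorem ofReal_integral_twoPow_ddcForm_radialWeight_plane (hP : finrank ℂ P = q + 1) (b : P) {ρ : ℝ}
    (hρ : 0 < ρ) {h : ℝ → ℝ} {s ε : ℝ} (hh : IsProfileTransition h s ε) (hs : s + ε ≤ Real.log ρ - 1) :
    ENNReal.ofReal ((((q + 1).factorial : ℝ) * 2 ^ (q + 1))⁻¹ *
      ∫ z in (plane (⊤ : Submodule ℂ P) (finrank_top_eq hP)).carrier ∩ ball b ρ,
        (ddcForm (radialWeight h s ε b) z).twoPow (q + 1)
          ((plane (⊤ : Submodule ℂ P) (finrank_top_eq hP)).orientationFrame z) ∂(μHE[2 * (q + 1)] : Measure P)) =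
      unitBallVolume (2 * (q + 1)) := by
  have hΩ : closedBall b ρ ⊆ ((⊤ : TopologicalSpace.Opens P) : Set P) := fun _ _ => trivial
  obtain ⟨Λ, _, hlim, hdata⟩ := exists_lelong_data (hasPureDim_planeSet (⊤ : Submodule ℂ P) (finrank_top_eq hP)) hρ hΩ
  have hΛ : Λ = unitBallVolume (2 * (q + 1)) := tendsto_nhds_unique hlim (tendsto_measure_ball_div_pow_plane hP b)
  have := hdata ρ ⟨hρ, le_rfl⟩ h s ε hh hs
  rw [show ofSet (planeSet (⊤ : Submodule ℂ P)) (hasPureDim_planeSet ⊤ (finrank_top_eq hP)) =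
      plane (⊤ : Submodule ℂ P) (finrank_top_eq hP) from rfl, lelongW_plane_top_eq_zero hP, zero_add, hΛ] at this
  exact this

/-- **`∫_{B(b,ρ)} (dd^c w_h)(z)^{q+1}(e₀, i e₀, …) d𝓗^{2(q+1)} = (q+1)! 2^{q+1} c(2(q+1))`** for every unitary
`(q+1)`-frame `e` of the `(q+1)`-dimensional space `P`, `ρ > 0` and every profile `h` located left
of `log ρ - 1` (the real-valued form, on the real frame of a fixed unitary basis).
[cite: Chirka1989, §15.1] -/
theorem integral_ball_twoPow_ddcForm_radialWeight (hP : finrank ℂ P = q + 1) (b : P) {ρ : ℝ}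
    (hρ : 0 < ρ) {h : ℝ → ℝ} {s ε : ℝ} (hh : IsProfileTransition h s ε) (hs : s + ε ≤ Real.log ρ - 1)
    {e : Fin (q + 1) → P} (he : Orthonormal ℂ e) :
    ∫ z in ball b ρ, (ddcForm (radialWeight h s ε b) z).twoPow (q + 1) (complexFrame e)
        ∂(μHE[2 * (q + 1)] : Measure P) =
      ((q + 1).factorial : ℝ) * 2 ^ (q + 1) * (unitBallVolume (2 * (q + 1))).toReal := by
  have hc : 0 < ((q + 1).factorial : ℝ) * 2 ^ (q + 1) := by positivity
  have h1 := ofReal_integral_twoPow_ddcForm_radialWeight_plane hP b hρ hh hs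
  rw [carrier_plane_top hP, univ_inter] at h1
  simp_rw [apply_orientationFrame_plane_top_eq hP _ he] at h1
  set J := ∫ z in ball b ρ, (ddcForm (radialWeight h s ε b) z).twoPow (q + 1) (complexFrame e)
    ∂(μHE[2 * (q + 1)] : Measure P) with hJ
  have hcb := unitBallVolume_ne_zero_ne_top (2 * (q + 1))
  -- the left side is non-negative (else its `ofReal` would vanish)
  have hnn : 0 ≤ (((q + 1).factorial : ℝ) * 2 ^ (q + 1))⁻¹ * J := by
    by_contra hneg
    rw [ENNReal.ofReal_of_nonpos (not_le.1 hneg).le] at h1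
    exact hcb.1 h1.symm
  have h2 := congrArg ENNReal.toReal h1
  rw [ENNReal.toReal_ofReal hnn] at h2
  field_simp at h2
  linarith

end HolomorphicChain

end Literature.Geometry.Kaehler

end
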